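import Literature.MathematicalPhysics.QuantumFieldTheory.Balaban1983to89.B9Eq353FormDefectTowerPiTwoBackgrounds
import Literature.MathematicalPhysics.QuantumFieldTheory.Balaban1983to89.B9Thm311LaplaceAkPiPositiveDiagonal
import Literature.MathematicalPhysics.QuantumFieldTheory.Balaban1983to89.B9Eq3126H1LipschitzEnergy

/-!
# `Balaban1983to89.B9Eq3126H1kLipschitzEnergyPiTwoBackgrounds` — T. Bałaban, *Propagators for lattice gauge theories in a background field*, Commun. Math.
# Phys. **99** (1985) 389–434 [Balaban1985BackgroundPropagators] (3.126) p. 420, (3.122) p. 420, Thm 3.4 p. 400, (3.84)–(3.86) p. 407, and T. Bałaban, *The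
# variational problem …*, Commun. Math. Phys. **102** (1985) 277–309 [Balaban1985Variational] (45)–(46) p. 285: **PRINT's MINIMISER `H̃_{1,k} = G̃_kQ_k*(Q_kG̃_kQ_k*)⁻¹`
# AT THE OPERATOR (3.122) IS LIPSCHITZ BETWEEN TWO SMALL BACKGROUNDS IN THE FLAT ENERGY NORM ON THE DIAGONAL, MODULO THE TWO `K̃⁻¹`-LETTERS —
# `‖H̃_{1,k}(U)b − H̃_{1,k}(V)b‖, ‖curl₁(…)‖, ‖div₁(…)‖ ≤ C·δ·‖b‖` WITH ONE `∃ α₀ δ₀ C` BEFORE EVERY BINDER** — the π twin ((T4)-3) of this lineage's gen-77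
# `B9Eq3126H1kLipschitzEnergyTwoBackgrounds` (the same row at the chain's `G₀`-slot), with the `R`-letter `C_R^{(2)}` no longer displayed

statement-level skeleton of published theorems with citation tags; proofs where landed; nothing here is a claim about the Yang–Mills mass gap

PDF held: `paper:balaban1985-cmp99-background-propagators` (journal page = PDF page + 388), pp. 400, 407, 420; `paper:balaban1985-cmp102-variational-background` p. 285 —
through the suppliers' quotations.

CITATION HEADER (lean-in-tree rule 2026-08-18).  Audit cell `pub-balaban`, sub-cell `t4`, NE9 crux team (2): LEAF PROVER 04 (`b2b-balaban-t4-ne9-formalise-leaf-04`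
gen 79), INTENT-5 = (T4)-3 (the row OWNER t4-ne9-p1's GO `CLAIMS.log` l.53352 W-9 (α) «(T3)∕(T4) the π twins … for the successor»).  WHY (cell context;
DIAGNOSIS D-ne9p1-g87-1, the `Δ_π` port): the (117) letter defects between two coupling histories at PRINT's operator need the `H̃`- and `𝔊̃`-rows between `U` and
`V`; this is the `H̃`-row, VERBATIM the gen-77 INTENT-10 text with the two suppliers swapped for their π twins.

THE PRINT.  (3.126) p. 420: `H_k = G_k Q_k^* (Q_k G_k Q_k^*)^{-1}` (verbatim via the OWNER's storey 5: *«HB = GQ*(QGQ*)⁻¹B»*); p. 400 Thm 3.4 (verbatim via (T2)):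
*«G(U) is an analytic function of U′ on the space of configurations U′ satisfying (3.35)»* — read as first-order Lipschitz continuity; [B11] (45)–(46) p. 285.

WHAT IS PROVED (sorry-free; 0 `def`; [folklore] composition BY NAME; nothing of [B9] asserted as printed).
* **`exists_norm_H1kPi_sub_H1kPi_le_two_backgrounds_closed`** — `∃ α₀ δ₀ C > 0` (`C` closed in `(d, a, a′, L, M_φ, M_φ′, r, C_τ, ρ_w, C_{K,V}, C_{K,U})`) BEFORE the
  binders of `B9Eq353FormDefectTowerPiTwoBackgrounds.exists_form_defect_pi_two_backgrounds_letterfree` (E162's data at `U`, `V`; level smallness ∕ closeness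
  profiles; `hRS` ×2, `U1` ×2, the four windows, the two closeness windows; ANY `hpos′_U`, `hpos′_V` defining `G′_k`), then for ANY positivity witnesses `hposU`,
  `hposV` of `Δ̃_{a,k}(U)`, `Δ̃_{a,k}(V)`, ANY onto-witnesses `hQU`, `hQV`, the two `K̃⁻¹`-letters `‖K̃_k(V)⁻¹b‖ ≤ C_{K,V}‖b‖`, `‖K̃_k(U)⁻¹c‖ ≤ C_{K,U}‖c‖` and every block
  field `b`: `‖H̃_k(U)b − H̃_k(V)b‖, ‖curl₁(…)‖, ‖div₁(…)‖ ≤ C·δ·‖b‖`, `H̃_k(X) = H1LatticeK hposX hQX` (the structure at `laplaceAkPi … X …`).  MECHANISM: the minimiser's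
  exact defect identity `B9Eq3126H1LipschitzEnergy.norm_apply_H1K_sub_le` (structures 0 := `V`, 1 := `U`) at the coercivities `γ` (flat weight) of `Δ̃_{a,k}(U)`,
  `Δ̃_{a,k}(V)` (the OWNER's `B9Thm311LaplaceAkPiPositiveDiagonal.exists_laplaceAkPi_coercive_diagonal_closed` at `U` AND `V`; the averaged `U1` by `hLb_of_hU1`), the
  two-background form defect `Θδ` of `Δ̃_{a,k}` ((T4)-1) and the averaging defect `s_Qδ` (`norm_QkW_sub_QkW_le_L2_linear`).  No operator bound, no `H`-letter, no
  Neumann series.  The `K̃⁻¹`-letters' closed supplier on the diagonal is NE9 leaf-02's `B9Eq3126KFloorSlotDiagonalClosed` (not consumed here: displayed, as in the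
  `G₀`-slot file).
MODEL ∕ DECLARED READINGS.  Those of (T4)-1 and of the OWNER's storey 5 (`K⁻¹`-letters and the four witnesses as binders).
HONEST SCOPE.  FIRST order between two small backgrounds on the diagonal ONLY; the `L²`∕energy clause — no kernel bound, no decay, NOT [B9] Thm 3.12; crude
constants.  NOT summit progress (cell pub-balaban: NE9 NOT PRINTED ∕ NOT PROVED; «NE9 ⇐ the named binders»; row WALLED ON A MODEL (O-NE9-1; #5 UNRULED); spine
PROVED 0∕9; rung (B)+1 finite T⁴ — NOT infinite volume, NOT mass gap, NOT BetaPertH, NOT Clay).  HONEST DEPENDENCY (cell line): continuum YM on T⁴ ⇐ BetaPertH ∧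
nine spine estimates (0/9 proved); BetaPertH ⇐ (D1) ∧ (D4) ∧ CAP+tail; G-an2-4 gates asym, D1 and NE2/3/4.  NEW file; nothing modified.  Net new unproved facts: 0.
-/

noncomputable section

open scoped InnerProductSpace ComplexConjugate BigOperators

namespace Literature.MathematicalPhysics.QuantumFieldTheory.Balaban1983to89.B9Eq3126H1kLipschitzEnergyPiTwoBackgrounds

open B4Sect5Torus (TSite)
open B9SectCLatticeCarrier (Bond)
open B11Eq103H1Complex (SiteL2K BondL2K covDerivL2K covDivL2K H1LatticeK KinvLatticeK H1K KinvK adjoint_injective_of_surjective)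
open B9Eq310HessianOperator (adTransportW hessOp covCurlL2K)
open B9Eq310DeltaPrime (plaqHolU)
open B9Eq315QTorus (perCfg cornerSite)
open B9Eq315QTower (towerP UlevOf)
open B9Eq326OperatorTower (QkW RofUk)
open B9Eq324DeltaPrimeATower (laplacePrimeAk)
open B9Eq3119DeltaPiTower (laplaceAkPi)
open B7Prop1Explicit (U1 Wcx boxVec)
open B9Thm311SmallFieldCoercivityTowerClosed (hLb_of_hU1)
open B9Eq315QTowerLipschitzL2TwoBackgroundsChain (norm_QkW_sub_QkW_le_L2_linear)
open B9Thm311LaplaceAkPiPositiveDiagonal (exists_laplaceAkPi_coercive_diagonal_closed)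
open B9Eq353FormDefectTowerPiTwoBackgrounds (exists_form_defect_pi_two_backgrounds_letterfree)
open B9Eq3126H1LipschitzEnergy (norm_apply_H1K_sub_le)

/-- on the diagonal the carrier ratio is `1`: `√(c₁∕(c₀(L^{n+1})^d)) = 1`. [cite: Balaban1985BackgroundPropagators, (3.16) p.393] -/
private theorem sqrt_ratio_diagonal {d L n : ℕ} {c₀ c₁ : ℝ} (hc₁ : 0 < c₁) (hw : c₀ * ((L : ℝ) ^ (n + 1)) ^ d = c₁) :
    Real.sqrt (c₁ / (c₀ * ((L : ℝ) ^ (n + 1)) ^ d)) = 1 := by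
  rw [hw, div_self hc₁.ne', Real.sqrt_one]

/-- `x ≤ √S` from `x² ≤ S`, `x ≥ 0`. [folklore] -/
private theorem le_sqrt_of_sq_le {x S : ℝ} (hx : 0 ≤ x) (h : x ^ 2 ≤ S) : x ≤ Real.sqrt S := by
  rw [← Real.sqrt_sq hx]; exact Real.sqrt_le_sqrt h

variable {d : ℕ} (L : ℕ) [NeZero L] (hL : 1 ≤ L)
  {𝔸 : Type*} [NormedRing 𝔸] [NormedAlgebra ℂ 𝔸] [CompleteSpace 𝔸] [NormOneClass 𝔸] [StarRing 𝔸] [NormedStarGroup 𝔸] [StarModule ℂ 𝔸]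
  {W : Type*} [NormedAddCommGroup W] [InnerProductSpace ℂ W] [FiniteDimensional ℂ W] (φ : W ≃ₗ[ℂ] 𝔸)
  {Mφ Mφ' : ℝ} (hMφ : 0 ≤ Mφ) (hMφ' : 0 ≤ Mφ') (hφ : ∀ w, ‖φ w‖ ≤ Mφ * ‖w‖) (hφ' : ∀ X, ‖φ.symm X‖ ≤ Mφ' * ‖X‖)
  {a : ℝ} (ha : 0 < a) {a' : ℝ} (ha' : 0 < a') {r : ℝ} (hr0 : 0 ≤ r) (hr1 : r < 1)
  (τ : 𝔸 →ₗ[ℂ] ℂ) {Cτ : ℝ} (hτ : ∀ X, ‖τ X‖ ≤ Cτ * ‖X‖) (hCτ : 0 ≤ Cτ) {ρw : ℝ} (hρw : 0 ≤ ρw)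
  {CKV CKU : ℝ} (hCKV : 0 ≤ CKV) (hCKU : 0 ≤ CKU)

include hMφ hMφ' hφ hφ' ha ha' hr0 hr1 hτ hCτ hρw hCKV hCKU

-- deep definitional unfolding `H1LatticeK`∕`KinvLatticeK` ↦ `H1K`∕`KinvK` and `laplaceAkPi` ↦ `laplaceALatticeK …` (as in the owner's storey 5)
set_option maxRecDepth 8192 in
/-- **`H̃_{1,k}(U) − H̃_{1,k}(V) = O(δ)` IN THE FLAT ENERGY NORM ON THE DIAGONAL, MODULO `C_{K,V}`, `C_{K,U}`** — see the module header: `∃ α₀ δ₀ C > 0` (closed)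
before every binder; then for ANY `hpos′_U`, `hpos′_V`, ANY positivity witnesses `hposU`, `hposV` of `Δ̃_{a,k}(U)`, `Δ̃_{a,k}(V)`, ANY onto-witnesses `hQU`, `hQV`, the two
`K̃⁻¹`-letters and every block field `b`: `‖H̃_k(U)b − H̃_k(V)b‖, ‖curl₁(…)‖, ‖div₁(…)‖ ≤ C·δ·‖b‖`. [folklore]
[cite: Balaban1985BackgroundPropagators, (3.126) p.420, (3.122) p.420, Thm 3.4 p.400, (3.84)–(3.86) p.407, (3.35) p.396; Balaban1985Variational, (45)–(46) p.285] -/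
theorem exists_norm_H1kPi_sub_H1kPi_le_two_backgrounds_closed :
    ∃ α₀ δ₀ C : ℝ, 0 < α₀ ∧ 0 < δ₀ ∧ 0 < C ∧ ∀ (n : ℕ) (η : ℝ), η * (L : ℝ) ^ (n + 1) = 1 →
      ∀ (c₀ c₁ : ℝ) [Fact (0 < c₀)] [Fact (0 < c₁)], c₀ * ((L : ℝ) ^ (n + 1)) ^ d = c₁ → |η| ^ d / c₀ ≤ ρw →
      ∀ (m : Fin d → ℕ) [∀ i, NeZero (m i)] (U V : Bond d (towerP L m (n + 1)) → 𝔸ˣ) (αU : ℕ → ℝ) (hα1 : ∀ j, αU j ≤ 1 / 64)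
        (hU1 : ∀ (j : ℕ) (x : B7Prop1Explicit.Site d) (κ : Fin d), perCfg (towerP L m (j + 1)) (UlevOf L m (n + 1) U j) x κ ∈ U1 𝔸)
        (hreg : ∀ (j : ℕ) (y : TSite d (towerP L m j)) (κ : Fin d) (r : Fin d → Fin L),
          ‖((Wcx L (perCfg (towerP L m (j + 1)) (UlevOf L m (n + 1) U j)) (cornerSite L y) κ (boxVec L r) : 𝔸ˣ) : 𝔸) - 1‖ ≤ αU j)
        (αV : ℕ → ℝ) (hα1' : ∀ j, αV j ≤ 1 / 64)
        (hV1 : ∀ (j : ℕ) (x : B7Prop1Explicit.Site d) (κ : Fin d), perCfg (towerP L m (j + 1)) (UlevOf L m (n + 1) V j) x κ ∈ U1 𝔸)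
        (hregV : ∀ (j : ℕ) (y : TSite d (towerP L m j)) (κ : Fin d) (r : Fin d → Fin L),
          ‖((Wcx L (perCfg (towerP L m (j + 1)) (UlevOf L m (n + 1) V j)) (cornerSite L y) κ (boxVec L r) : 𝔸ˣ) : 𝔸) - 1‖ ≤ αV j),
        (∀ j, αV j ≤ 1 / 128) →
      ∀ (εU : ℕ → ℝ), (∀ j, 0 ≤ εU j) → (∀ (j : ℕ) (b : Bond d (towerP L m (j + 1))), ‖(UlevOf L m (n + 1) U j b : 𝔸) - 1‖ ≤ εU j) →
        (∀ (j : ℕ) (b : Bond d (towerP L m (j + 1))), ‖(UlevOf L m (n + 1) V j b : 𝔸) - 1‖ ≤ εU j) →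
      ∀ (δUV : ℕ → ℝ), (∀ j, 0 ≤ δUV j) →
        (∀ (j : ℕ) (b : Bond d (towerP L m (j + 1))), ‖(UlevOf L m (n + 1) U j b : 𝔸) - (UlevOf L m (n + 1) V j b : 𝔸)‖ ≤ δUV j) →
      ∀ {α δ : ℝ}, 0 ≤ α → α ≤ α₀ → 0 ≤ δ → δ ≤ δ₀ →
        (∀ (b : Bond d (towerP L m (n + 1))) (v u : W), ⟪adTransportW φ U b v, u⟫_ℂ = ⟪v, adTransportW φ (fun b => (U b)⁻¹) b u⟫_ℂ) →
        (∀ (b : Bond d (towerP L m (n + 1))) (v u : W), ⟪adTransportW φ V b v, u⟫_ℂ = ⟪v, adTransportW φ (fun b => (V b)⁻¹) b u⟫_ℂ) →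
        (∀ b, U b ∈ U1 𝔸) → (∀ b, V b ∈ U1 𝔸) → (∀ b, ‖(U b : 𝔸) - 1‖ ≤ α * η) → (∀ b, ‖(V b : 𝔸) - 1‖ ≤ α * η) →
        (∀ p : B9SectCLatticeCarrier.Plaq d (towerP L m (n + 1)), ‖(plaqHolU U p : 𝔸) - 1‖ ≤ α * η ^ 2) →
        (∀ p : B9SectCLatticeCarrier.Plaq d (towerP L m (n + 1)), ‖(plaqHolU V p : 𝔸) - 1‖ ≤ α * η ^ 2) →
        (∀ b, ‖(U b : 𝔸) - (V b : 𝔸)‖ ≤ δ * η) →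
        (∀ p : B9SectCLatticeCarrier.Plaq d (towerP L m (n + 1)), ‖(plaqHolU U p : 𝔸) - (plaqHolU V p : 𝔸)‖ ≤ δ * η ^ 2) →
        (∀ j < n + 1, εU j ≤ α * r ^ j) → (∀ j, δUV j ≤ δ * r ^ j) →
        ∀ (hposU' : ∀ x : SiteL2K ℂ d (towerP L m (n + 1)) c₀ W, x ≠ 0 → 0 < RCLike.re ⟪x, laplacePrimeAk L m n φ η U a' (c₁ := c₁) x⟫_ℂ)
          (hposV' : ∀ x : SiteL2K ℂ d (towerP L m (n + 1)) c₀ W, x ≠ 0 → 0 < RCLike.re ⟪x, laplacePrimeAk L m n φ η V a' (c₁ := c₁) x⟫_ℂ)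
          (hposU : ∀ x : BondL2K ℂ d (towerP L m (n + 1)) c₀ W, x ≠ 0 →
            0 < RCLike.re ⟪x, laplaceAkPi L m n φ τ η U a' hposU' hL αU hα1 hU1 hreg (c₁ := c₁) a x⟫_ℂ)
          (hposV : ∀ x : BondL2K ℂ d (towerP L m (n + 1)) c₀ W, x ≠ 0 →
            0 < RCLike.re ⟪x, laplaceAkPi L m n φ τ η V a' hposV' hL αV hα1' hV1 hregV (c₁ := c₁) a x⟫_ℂ)
          (hQU : Function.Surjective (QkW L m n φ U hL αU hα1 hU1 hreg (c₀ := c₀) (c₁ := c₁)))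
          (hQV : Function.Surjective (QkW L m n φ V hL αV hα1' hV1 hregV (c₀ := c₀) (c₁ := c₁))),
        (∀ b : BondL2K ℂ d m c₁ W, ‖KinvLatticeK hposV hQV b‖ ≤ CKV * ‖b‖) →
        (∀ c : BondL2K ℂ d m c₁ W, ‖KinvLatticeK hposU hQU c‖ ≤ CKU * ‖c‖) →
        ∀ b : BondL2K ℂ d m c₁ W,
          ‖H1LatticeK hposU hQU b - H1LatticeK hposV hQV b‖ ≤ C * δ * ‖b‖ ∧
          ‖covCurlL2K ℂ c₀ ((η : ℂ))⁻¹ (adTransportW φ (fun _ : Bond d (towerP L m (n + 1)) => (1 : 𝔸ˣ))) (H1LatticeK hposU hQU b - H1LatticeK hposV hQV b)‖ ≤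
            C * δ * ‖b‖ ∧
          ‖covDivL2K ℂ c₀ ((η : ℂ))⁻¹ (adTransportW φ fun _ : Bond d (towerP L m (n + 1)) => (1 : 𝔸ˣ)⁻¹) (H1LatticeK hposU hQU b - H1LatticeK hposV hQV b)‖ ≤
            C * δ * ‖b‖ := by
  obtain ⟨α₁, γ₁, hα₁, hγ₁, H1⟩ := exists_laplaceAkPi_coercive_diagonal_closed (d := d) L hL φ hMφ hMφ' hφ hφ' ha ha' hr0 hr1 τ hτ hCτ hρw
  obtain ⟨α₂, δ₂, Θ, hα₂, hδ₂, hΘ, H2⟩ :=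
    exists_form_defect_pi_two_backgrounds_letterfree (d := d) L hL φ hMφ hMφ' hφ hφ' ha ha' hr0 hr1 τ hτ hCτ hρw
  have hL1 : (1 : ℝ) ≤ L := by exact_mod_cast hL
  have h1r : 0 < 1 - r := by linarith
  obtain ⟨Ξ, hΞdef⟩ : ∃ Ξ : ℝ, Ξ = Real.sqrt ((L : ℝ) ^ d) * (Real.sqrt (2 * d) * (102 * (d + 1) ^ 2 * L)) := ⟨_, rfl⟩
  obtain ⟨BQ, hBQdef⟩ : ∃ BQ : ℝ, BQ = Real.sqrt ((L : ℝ) ^ d) * (Real.sqrt (2 * d) * (75497472 * ((d : ℝ) + 1) * ((2 * (d * L) + L + L : ℕ) : ℝ))) / (1 - r) := ⟨_, rfl⟩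
  obtain ⟨sQ, hsQdef⟩ : ∃ sQ : ℝ, sQ = Mφ' * Mφ * (2 * Real.exp 1 * BQ) := ⟨_, rfl⟩
  have hΞ0 : 0 ≤ Ξ := by rw [hΞdef]; positivity
  have hBQ : 0 ≤ BQ := by rw [hBQdef]; positivity
  have hsQ : 0 ≤ sQ := by rw [hsQdef]; positivity
  have hMM : 0 ≤ Mφ' * Mφ := mul_nonneg hMφ' hMφ
  have hNN : (0 : ℝ) < 12288 * ((2 * (d * L) + L + L : ℕ) : ℝ) := by
    have : (1 : ℝ) ≤ ((2 * (d * L) + L + L : ℕ) : ℝ) := by exact_mod_cast (show 1 ≤ 2 * (d * L) + L + L by nlinarith [hL])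
    positivity
  obtain ⟨Cb, hCbdef⟩ : ∃ Cb : ℝ, Cb = (Θ * Real.sqrt (CKV / γ₁) + sQ * CKV) / γ₁ + Real.sqrt (CKU / γ₁) * (sQ * Real.sqrt (CKV / γ₁)) := ⟨_, rfl⟩
  have hCb : 0 ≤ Cb := by rw [hCbdef]; positivity
  refine ⟨min (min α₁ α₂) ((1 - r) / (Ξ + 1)), min δ₂ (min (1 / (12288 * ((2 * (d * L) + L + L : ℕ) : ℝ))) (1 / (BQ + 1))), Cb + 1,
    lt_min (lt_min hα₁ hα₂) (by positivity), lt_min hδ₂ (lt_min (by positivity) (by positivity)), by positivity, ?_⟩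
  intro n η hηL c₀ c₁ _ _ hw hρ m _ U V αU hα1 hU1 hreg αV hα1' hV1 hregV hα128 εU hεU hUε hVε δUV hδUV hLUV α δ hα0 hαle hδ0 hδle
    hRSU hRSV hUb hVb hUη hVη hplU hplV hUV hpp hεg hδg hposU' hposV' hposU hposV hQU hQV hKV hKU b
  have hLbU := hLb_of_hU1 L m n U hU1
  have hLbV := hLb_of_hU1 L m n V hV1
  have hc₁ : 0 < c₁ := Fact.out
  have hαα₁ : α ≤ α₁ := hαle.trans ((min_le_left _ _).trans (min_le_left _ _))
  have hαα₂ : α ≤ α₂ := hαle.trans ((min_le_left _ _).trans (min_le_right _ _))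
  have hδδ₂ : δ ≤ δ₂ := hδle.trans (min_le_left _ _)
  have hδN : δ ≤ 1 / (12288 * ((2 * (d * L) + L + L : ℕ) : ℝ)) := hδle.trans ((min_le_right _ _).trans (min_le_left _ _))
  have hδB : BQ * δ ≤ 1 := by
    have h1 : δ ≤ 1 / (BQ + 1) := hδle.trans ((min_le_right _ _).trans (min_le_right _ _))
    calc BQ * δ ≤ BQ * (1 / (BQ + 1)) := mul_le_mul_of_nonneg_left h1 hBQ
      _ ≤ 1 := by rw [mul_one_div, div_le_one (by positivity)]; linarith
  have hαΞ : Ξ * (α / (1 - r)) ≤ 1 := by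
    have h1 : α ≤ (1 - r) / (Ξ + 1) := hαle.trans (min_le_right _ _)
    rw [← mul_div_assoc, div_le_one h1r]
    calc Ξ * α ≤ Ξ * ((1 - r) / (Ξ + 1)) := mul_le_mul_of_nonneg_left h1 hΞ0
      _ ≤ 1 - r := by
          rw [mul_div_assoc', div_le_iff₀ (add_pos_of_nonneg_of_pos hΞ0 one_pos)]
          calc Ξ * (1 - r) ≤ Ξ * (1 - r) + (1 - r) := le_add_of_nonneg_right h1r.le
            _ = (1 - r) * (Ξ + 1) := by ring
  have hsQδ : 0 ≤ sQ * δ := mul_nonneg hsQ hδ0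
  have hΘδ : 0 ≤ Θ * δ := mul_nonneg hΘ.le hδ0
  have hCfin : ((Θ * δ) * Real.sqrt (CKV / γ₁) + (sQ * δ) * CKV) / γ₁ + Real.sqrt (CKU / γ₁) * ((sQ * δ) * Real.sqrt (CKV / γ₁)) = Cb * δ := by
    rw [hCbdef]; ring
  have hCb1 : Cb * δ * ‖b‖ ≤ (Cb + 1) * δ * ‖b‖ :=
    mul_le_mul_of_nonneg_right (mul_le_mul_of_nonneg_right (le_add_of_nonneg_right zero_le_one) hδ0) (norm_nonneg _)
  have HU := H1 n η hηL c₀ c₁ hw hρ m U αU hα1 hU1 hreg εU hεU hUε hα0 hαα₁ hRSU hUb hUη hplU hεg hLbU hposU'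
  have HV := H1 n η hηL c₀ c₁ hw hρ m V αV hα1' hV1 hregV εU hεU hVε hα0 hαα₁ hRSV hVb hVη hplV hεg hLbV hposV'
  have HT := H2 n η hηL c₀ c₁ hw hρ m U V αU hα1 hU1 hreg αV hα1' hV1 hregV hα128 εU hεU hUε hVε δUV hδUV hLUV hα0 hαα₂ hδ0 hδδ₂ hRSU hRSV
    hUb hVb hUη hVη hplU hplV hUV hpp hεg hδg hposU' hposV'
  obtain ⟨N, hNdef⟩ : ∃ N : BondL2K ℂ d (towerP L m (n + 1)) c₀ W → ℝ, N = fun z =>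
      Real.sqrt (‖covCurlL2K ℂ c₀ ((η : ℂ))⁻¹ (adTransportW φ (fun _ : Bond d (towerP L m (n + 1)) => (1 : 𝔸ˣ))) z‖ ^ 2 + ‖covDivL2K ℂ c₀ ((η : ℂ))⁻¹ (adTransportW φ fun _ : Bond d (towerP L m (n + 1)) => (1 : 𝔸ˣ)⁻¹) z‖ ^ 2 + ‖z‖ ^ 2) := ⟨_, rfl⟩
  have hNz : ∀ z, N z = Real.sqrt (‖covCurlL2K ℂ c₀ ((η : ℂ))⁻¹ (adTransportW φ (fun _ : Bond d (towerP L m (n + 1)) => (1 : 𝔸ˣ))) z‖ ^ 2 + ‖covDivL2K ℂ c₀ ((η : ℂ))⁻¹ (adTransportW φ fun _ : Bond d (towerP L m (n + 1)) => (1 : 𝔸ˣ)⁻¹) z‖ ^ 2 + ‖z‖ ^ 2) := fun z => by rw [hNdef]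
  have hN0 : ∀ z, 0 ≤ N z := fun z => by rw [hNz]; exact Real.sqrt_nonneg _
  have hNsq : ∀ z, N z ^ 2 = ‖covCurlL2K ℂ c₀ ((η : ℂ))⁻¹ (adTransportW φ (fun _ : Bond d (towerP L m (n + 1)) => (1 : 𝔸ˣ))) z‖ ^ 2 + ‖covDivL2K ℂ c₀ ((η : ℂ))⁻¹ (adTransportW φ fun _ : Bond d (towerP L m (n + 1)) => (1 : 𝔸ˣ)⁻¹) z‖ ^ 2 + ‖z‖ ^ 2 := fun z => by
    rw [hNz]; exact Real.sq_sqrt (add_nonneg (add_nonneg (sq_nonneg _) (sq_nonneg _)) (sq_nonneg _))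
  have hNn : ∀ z, ‖z‖ ≤ N z := fun z => by
    rw [hNz]; exact le_sqrt_of_sq_le (norm_nonneg _) (le_add_of_nonneg_left (add_nonneg (sq_nonneg _) (sq_nonneg _)))
  have hNc : ∀ z, ‖covCurlL2K ℂ c₀ ((η : ℂ))⁻¹ (adTransportW φ (fun _ : Bond d (towerP L m (n + 1)) => (1 : 𝔸ˣ))) z‖ ≤ N z := fun z => by
    rw [hNz]; exact le_sqrt_of_sq_le (norm_nonneg _) ((le_add_of_nonneg_right (sq_nonneg _)).trans (le_add_of_nonneg_right (sq_nonneg _)))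
  have hNd : ∀ z, ‖covDivL2K ℂ c₀ ((η : ℂ))⁻¹ (adTransportW φ fun _ : Bond d (towerP L m (n + 1)) => (1 : 𝔸ˣ)⁻¹) z‖ ≤ N z := fun z => by
    rw [hNz]; exact le_sqrt_of_sq_le (norm_nonneg _) ((le_add_of_nonneg_left (sq_nonneg _)).trans (le_add_of_nonneg_right (sq_nonneg _)))
  have hNid : ∀ z : BondL2K ℂ d (towerP L m (n + 1)) c₀ W, ‖(LinearMap.id : BondL2K ℂ d (towerP L m (n + 1)) c₀ W →ₗ[ℂ] BondL2K ℂ d (towerP L m (n + 1)) c₀ W) z‖ ≤ N z :=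
    fun z => by rw [LinearMap.id_apply]; exact hNn z
  have hcoerU : ∀ z, γ₁ * N z ^ 2 ≤ RCLike.re ⟪z, laplaceAkPi L m n φ τ η U a' hposU' hL αU hα1 hU1 hreg (c₁ := c₁) a z⟫_ℂ := fun z => by
    rw [hNsq]; exact HU z
  have hcoerV : ∀ z, γ₁ * N z ^ 2 ≤ RCLike.re ⟪z, laplaceAkPi L m n φ τ η V a' hposV' hL αV hα1' hV1 hregV (c₁ := c₁) a z⟫_ℂ := fun z => by
    rw [hNsq]; exact HV z
  have hT : ∀ u v : BondL2K ℂ d (towerP L m (n + 1)) c₀ W, ‖⟪u, laplaceAkPi L m n φ τ η U a' hposU' hL αU hα1 hU1 hreg (c₁ := c₁) a v⟫_ℂ -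
      ⟪u, laplaceAkPi L m n φ τ η V a' hposV' hL αV hα1' hV1 hregV (c₁ := c₁) a v⟫_ℂ‖ ≤ Θ * δ * N u * N v :=
    fun u v => by rw [hNz u, hNz v]; exact HT u v
  have hδmax : ∀ j, δUV j ≤ 1 / (12288 * ((2 * (d * L) + L + L : ℕ) : ℝ)) := fun j =>
    (hδg j).trans ((mul_le_of_le_one_right hδ0 (pow_le_one₀ hr0 hr1.le)).trans hδN)
  have hwin : Real.sqrt ((L : ℝ) ^ d) * (Real.sqrt (2 * d) * (75497472 * ((d : ℝ) + 1) * ((2 * (d * L) + L + L : ℕ) : ℝ))) / (1 - r) * δ ≤ 1 := by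
    rw [← hBQdef]; exact hδB
  have hQd : ∀ w : BondL2K ℂ d (towerP L m (n + 1)) c₀ W, ‖(QkW L m n φ U hL αU hα1 hU1 hreg (c₀ := c₀) (c₁ := c₁)) w -
      (QkW L m n φ V hL αV hα1' hV1 hregV (c₀ := c₀) (c₁ := c₁)) w‖ ≤ (sQ * δ) * ‖w‖ := fun w => by
    have h := norm_QkW_sub_QkW_le_L2_linear L m n hL φ hMφ hMφ' hφ hφ' (c₀ := c₀) (c₁ := c₁) U V αU hα1 hU1 hreg αV hα1' hV1 hregV hα128 εU hεU hUε hVε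
      δUV hδUV hδmax hLUV hr0 hr1 hα0 hδ0 hεg (fun j _ => hδg j) hwin w
    rw [sqrt_ratio_diagonal hc₁ hw, mul_one, ← hBQdef] at h
    have hexp : Real.exp (Real.sqrt ((L : ℝ) ^ d) * (Real.sqrt (2 * d) * (102 * (d + 1) ^ 2 * L)) * (α / (1 - r))) ≤ Real.exp 1 := by
      rw [← hΞdef]; exact Real.exp_le_exp.2 hαΞ
    have h2 : Mφ' * Mφ * (2 * Real.exp (Real.sqrt ((L : ℝ) ^ d) * (Real.sqrt (2 * d) * (102 * (d + 1) ^ 2 * L)) * (α / (1 - r))) * (BQ * δ)) ≤ sQ * δ := by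
      rw [hsQdef]
      have := mul_le_mul_of_nonneg_right hexp (mul_nonneg hBQ hδ0)
      calc Mφ' * Mφ * (2 * Real.exp (Real.sqrt ((L : ℝ) ^ d) * (Real.sqrt (2 * d) * (102 * (d + 1) ^ 2 * L)) * (α / (1 - r))) * (BQ * δ))
          = (Mφ' * Mφ * 2) * (Real.exp (Real.sqrt ((L : ℝ) ^ d) * (Real.sqrt (2 * d) * (102 * (d + 1) ^ 2 * L)) * (α / (1 - r))) * (BQ * δ)) := by ring
        _ ≤ (Mφ' * Mφ * 2) * (Real.exp 1 * (BQ * δ)) := mul_le_mul_of_nonneg_left this (by positivity)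
        _ = Mφ' * Mφ * (2 * Real.exp 1 * BQ) * δ := by ring
    exact h.trans (mul_le_mul_of_nonneg_right h2 (norm_nonneg _))
  have hadjU : ∀ (x : BondL2K ℂ d (towerP L m (n + 1)) c₀ W) (z : BondL2K ℂ d m c₁ W), ⟪(QkW L m n φ U hL αU hα1 hU1 hreg (c₀ := c₀) (c₁ := c₁)) x, z⟫_ℂ =
      ⟪x, LinearMap.adjoint (QkW L m n φ U hL αU hα1 hU1 hreg (c₀ := c₀) (c₁ := c₁)) z⟫_ℂ := fun x z => (LinearMap.adjoint_inner_right _ x z).symm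
  have hadjV : ∀ (x : BondL2K ℂ d (towerP L m (n + 1)) c₀ W) (z : BondL2K ℂ d m c₁ W), ⟪(QkW L m n φ V hL αV hα1' hV1 hregV (c₀ := c₀) (c₁ := c₁)) x, z⟫_ℂ =
      ⟪x, LinearMap.adjoint (QkW L m n φ V hL αV hα1' hV1 hregV (c₀ := c₀) (c₁ := c₁)) z⟫_ℂ := fun x z => (LinearMap.adjoint_inner_right _ x z).symm
  have hinjU := adjoint_injective_of_surjective _ hQU
  have hinjV := adjoint_injective_of_surjective _ hQV
  refine ⟨?_, ?_, ?_⟩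
  · refine le_trans ?_ hCb1
    rw [← hCfin]
    have h := norm_apply_H1K_sub_le (𝕜 := ℂ) hposV hadjV hinjV hposU hadjU hinjU N hN0 hNn hγ₁ hγ₁ hΘδ hsQδ hCKV hCKU hcoerU hcoerV hT hQd hKV hKU
      (LinearMap.id : BondL2K ℂ d (towerP L m (n + 1)) c₀ W →ₗ[ℂ] BondL2K ℂ d (towerP L m (n + 1)) c₀ W) hNid b
    rw [LinearMap.id_apply] at h
    exact h
  · refine le_trans ?_ hCb1
    rw [← hCfin]
    exact norm_apply_H1K_sub_le (𝕜 := ℂ) hposV hadjV hinjV hposU hadjU hinjU N hN0 hNn hγ₁ hγ₁ hΘδ hsQδ hCKV hCKU hcoerU hcoerV hT hQd hKV hKU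
      (covCurlL2K ℂ c₀ ((η : ℂ))⁻¹ (adTransportW φ (fun _ : Bond d (towerP L m (n + 1)) => (1 : 𝔸ˣ)))) hNc b
  · refine le_trans ?_ hCb1
    rw [← hCfin]
    exact norm_apply_H1K_sub_le (𝕜 := ℂ) hposV hadjV hinjV hposU hadjU hinjU N hN0 hNn hγ₁ hγ₁ hΘδ hsQδ hCKV hCKU hcoerU hcoerV hT hQd hKV hKU
      (covDivL2K ℂ c₀ ((η : ℂ))⁻¹ (adTransportW φ fun _ : Bond d (towerP L m (n + 1)) => (1 : 𝔸ˣ)⁻¹)) hNd b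

end Literature.MathematicalPhysics.QuantumFieldTheory.Balaban1983to89.B9Eq3126H1kLipschitzEnergyPiTwoBackgrounds

end
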